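import Mathlib
import Literature.NumberTheory.LFunctions.VinogradovZetaSumEstimate
import Summits.HodgeConjecture.FermatCycles.HodgeFermatHypVTailA

/-!
# HYPOTHESIS V beyond `30000` — part 2: the harmonic bound, the key lemma, orders and `tauV` (`HodgeFermat/HypVTail.lean`; HF-G33)

Tree copy (part 2 of 3) of the module `HodgeFermat/HypVTail.lean` of the sibling cell's standalone package
`run/shared/lean/pub/pub-hodgefermat/lean/HodgeFermat/` (799 lines, sha256 `1145426fd717b34a…`), source lines 357–531 (§2 the many-factor regime: partial fractions and the harmonic bound; §3 the numeric key lemma `key`; §4 orders and `tauV`: `log_le_orderOf`, `tauV_le`).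
Filed by cell `pub-hfermat`, seat prover-1 gen-2, on the COORDINATOR KEEPER RULING of 2026-08-25 (gem sweep H1: take the
off-gate kernel theorem `thmFstar` through the gate) — here its second namesake, `HodgeFermat/ThmFstarNFinal.lean:29`,
THEOREM F*(3N) at every admissible squarefree level (the first, `DecodingFinal.thmFstar` = THEOREM F* at the prime levels,
landed on 2026-08-25 as `HodgeFermatThmFstar.lean`, seat prover-1 gen-0); this file is one link of the import closure of
`ThmFstarNFinal.thmFstar` on top of that landed chain.  The source module's declarations are VERBATIM those of the cell record
`check/ThmFstarN_standalone.lean` (21 bodies, 438 871 B, sha256 ced731ec52c92191…, hub `lean check` rc 0, 222.2 s, `--axioms …ThmFstarN.thmFstarN` = [propext, Classical.choice, Quot.sound]; pub-hodgefermat `CERT.md` l.987, GATE HF-G33).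
Deviations from the source module, exhaustively: the `import` lines (tree modules `Summits.HodgeConjecture.FermatCycles.
HodgeFermat*` instead of `HodgeFermat.*`); this module docstring; the `set_option`/namespace/`open` preamble (source l.31–35) is repeated at the top because the module is split; DEDUP (the gate's `dedup.landed`, caught at dry-run): the source's `theorem harmonic_cast_le` (l.359–364, `Σ_{i<n} 1/(i+1) ≤ 1 + log n`) restates the landed `Literature.NumberTheory.LFunctions.VKZeta.sum_range_inv_succ_le'` (`Literature/NumberTheory/LFunctions/VinogradovZetaSumEstimate.lean`) VERBATIM up to the name of the bound variable and is therefore DELETED, the name re-bound to the Literature theorem by the added line `open Literature.NumberTheory.LFunctions.VKZeta renaming sum_range_inv_succ_le' → harmonic_cast_le` (extra import) so that both use sites (source l.390, 412) stay byte-identical; one-line docstring added (gate lint) to `log_le_lin64`. The module docstring is quoted in full in part 1.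
Every other line — in particular every declaration's statement and proof — is byte-identical to the source.
HONEST FRAMING: explicit algebraic cycles for specific Hodge classes on Fermat/Delsarte varieties; residual open instances
listed; no claim on general Hodge.  (This file is arithmetic of CM types / of `(ℤ/N)ˣ`; it claims nothing about cycles.)
-/

set_option autoImplicit false

namespace HodgeFermat.KRFree.HypVTail

open Finset HodgeFermat.KRFree.HypVDefs
open Literature.NumberTheory.LFunctions.VKZeta renaming sum_range_inv_succ_le' → harmonic_cast_le

/-! ## §2 The many-factor regime: partial fractions and the harmonic bound -/

-- `harmonic_cast_le` (source l.359–364): DELETED — verbatim restatement of the landed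
-- `Literature.NumberTheory.LFunctions.VKZeta.sum_range_inv_succ_le'`, re-bound by the `open … renaming …` line above.

/-- `log x ≤ x/64 + 3.159` for `x > 0` -/
theorem log_le_lin64 (x : ℝ) (hx : 0 < x) : Real.log x ≤ x / 64 + 3.159 := by
  have h1 : Real.log (x / 64) ≤ x / 64 - 1 := Real.log_le_sub_one_of_pos (by positivity)
  have h2 : Real.log (x / 64) = Real.log x - Real.log 64 := Real.log_div (ne_of_gt hx) (by norm_num)
  have h3 : Real.log 64 = 6 * Real.log 2 := by
    rw [show (64 : ℝ) = 2 ^ 6 by norm_num, Real.log_pow]; norm_num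
  have h4 := Real.log_two_lt_d9
  linarith

/-- `Σ_{i<k} 6 / ((i+5)(k-i)) < 9/10` for `k ≥ 50`. -/
theorem many_factor_sum (k : ℕ) (hk : 50 ≤ k) :
    ∑ i ∈ range k, (6 : ℝ) / (((i : ℝ) + 5) * ((k : ℝ) - i)) < 9 / 10 := by
  have hk0 : (0 : ℝ) < (k : ℝ) + 5 := by positivity
  -- partial fractions
  have hpf : ∀ i ∈ range k, (6 : ℝ) / (((i : ℝ) + 5) * ((k : ℝ) - i)) =
      6 / ((k : ℝ) + 5) * (1 / ((i : ℝ) + 5) + 1 / ((k : ℝ) - i)) := by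
    intro i hi
    have hik : (i : ℝ) < k := by exact_mod_cast mem_range.mp hi
    have h1 : ((k : ℝ) - i) ≠ 0 := by linarith
    have h2 : ((i : ℝ) + 5) ≠ 0 := by positivity
    field_simp
    ring
  rw [sum_congr rfl hpf, ← mul_sum, sum_add_distrib]
  -- the two harmonic pieces
  have hA : ∑ i ∈ range k, (1 : ℝ) / ((i : ℝ) + 5) ≤ Real.log ((k : ℝ) + 4) + 1 - 25 / 12 := by
    have h := harmonic_cast_le (4 + k)
    rw [Finset.sum_range_add] at h
    have h4 : ∑ x ∈ range 4, (1 : ℝ) / ((x : ℝ) + 1) = 25 / 12 := by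
      simp [Finset.sum_range_succ]; norm_num
    rw [h4] at h
    push_cast at h
    have e : ∑ i ∈ range k, (1 : ℝ) / ((i : ℝ) + 5) = ∑ x ∈ range k, (1 : ℝ) / (((4 : ℕ) : ℝ) + (x : ℝ) + 1) :=
      sum_congr rfl (fun i _ => by push_cast; ring)
    rw [e]
    have : Real.log ((4 : ℝ) + k) = Real.log ((k : ℝ) + 4) := by rw [add_comm]
    push_cast at this h ⊢
    linarith
  have hB : ∑ i ∈ range k, (1 : ℝ) / ((k : ℝ) - i) ≤ 1 + Real.log (k : ℝ) := by
    have href : ∑ i ∈ range k, (1 : ℝ) / ((k : ℝ) - i) = ∑ j ∈ range k, (1 : ℝ) / ((j : ℝ) + 1) := by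
      rw [← Finset.sum_range_reflect (fun j => (1 : ℝ) / ((j : ℝ) + 1)) k]
      apply sum_congr rfl
      intro i hi
      have hik : i < k := mem_range.mp hi
      have : ((k - 1 - i : ℕ) : ℝ) = (k : ℝ) - 1 - i := by
        rw [Nat.cast_sub (by omega), Nat.cast_sub (by omega)]; push_cast; ring
      rw [this]; ring
    rw [href]
    exact harmonic_cast_le k
  have hlog1 := log_le_lin64 ((k : ℝ) + 4) (by positivity)
  have hlog2 := log_le_lin64 (k : ℝ) (by exact_mod_cast (show 0 < k by omega))
  have hk' : (50 : ℝ) ≤ k := by exact_mod_cast hk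
  rw [div_mul_eq_mul_div, div_lt_iff₀ hk0]
  nlinarith

/-! ## §3 The numeric key lemma -/

/-- KEY LEMMA: for primes `p i ≥ lb k i` and naturals `d i ≥ max (E k (p i)) (k - i)` (`i < k`, `k ≥ 2`),
`12 / Φ_k + Σ_{i<k} 12 / ((p i - 1) · d i) < 1`. -/
theorem key (k : ℕ) (hk : 2 ≤ k) (p d : ℕ → ℕ) (hpr : ∀ i < k, (p i).Prime) (hp : ∀ i < k, lb k i ≤ p i)
    (hd1 : ∀ i < k, E k (p i) ≤ d i) (hd2 : ∀ i < k, k - i ≤ d i) :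
    (12 : ℝ) / (Phi k : ℝ) + ∑ i ∈ range k, (12 : ℝ) / ((((p i - 1 : ℕ) : ℝ)) * (d i : ℝ)) < 1 := by
  by_cases hk50 : k < 50
  · -- finite table
    have hfin : (bnd k : ℝ) < 1 := by exact_mod_cast bnd_lt_one k hk50 hk
    rw [bnd_cast] at hfin
    refine lt_of_le_of_lt (add_le_add le_rfl (sum_le_sum (fun i hi => ?_))) hfin
    have hik : i < k := mem_range.mp hi
    have hqi := qt_ge i
    have hli := qt_le_lb k i
    have hD : Dmin k (lb k i) (k - i) ≤ (p i - 1) * max (E k (p i)) (k - i) :=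
      den_ge k _ _ _ hk50 (by omega) (hp i hik) (hpr i hik)
    have hmax : max (E k (p i)) (k - i) ≤ d i := max_le (hd1 i hik) (hd2 i hik)
    have hD' : Dmin k (lb k i) (k - i) ≤ (p i - 1) * d i := le_trans hD (Nat.mul_le_mul le_rfl hmax)
    have hpos : 0 < Dmin k (lb k i) (k - i) :=
      lt_of_lt_of_le (Nat.mul_pos (by omega) (by omega)) (Dmin_ge k (lb k i) (k - i))
    have hD'' : (Dmin k (lb k i) (k - i) : ℝ) ≤ ((p i - 1 : ℕ) : ℝ) * (d i : ℝ) := by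
      exact_mod_cast hD'
    exact div_le_div_of_nonneg_left (by norm_num) (by exact_mod_cast hpos) hD''
  · -- many factors
    push Not at hk50
    have hPhi : (12 : ℝ) / (Phi k : ℝ) ≤ 1 / 10 := by
      have h := le_Phi k hk
      have h' : (120 : ℝ) ≤ (Phi k : ℝ) := by exact_mod_cast h
      rw [div_le_div_iff₀ (by linarith) (by norm_num)]
      linarith
    have hS : ∑ i ∈ range k, (12 : ℝ) / ((((p i - 1 : ℕ) : ℝ)) * (d i : ℝ))
        ≤ ∑ i ∈ range k, (6 : ℝ) / (((i : ℝ) + 5) * ((k : ℝ) - i)) := by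
      refine sum_le_sum (fun i hi => ?_)
      have hik : i < k := mem_range.mp hi
      have h1 : (2 * (i : ℝ) + 10) ≤ ((p i - 1 : ℕ) : ℝ) := by
        have := hp i hik
        have hqi := qt_ge i
        have hli := qt_le_lb k i
        have : 2 * i + 10 ≤ p i - 1 := by omega
        exact_mod_cast this
      have h2 : ((k : ℝ) - i) ≤ (d i : ℝ) := by
        have := hd2 i hik
        have : ((k - i : ℕ) : ℝ) ≤ d i := by exact_mod_cast this
        rwa [Nat.cast_sub hik.le] at this
      have hki : (0 : ℝ) < (k : ℝ) - i := by
        have : (i : ℝ) < k := by exact_mod_cast hik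
        linarith
      have hi5 : (0 : ℝ) < (i : ℝ) + 5 := by positivity
      calc (12 : ℝ) / (((p i - 1 : ℕ) : ℝ) * (d i : ℝ))
          ≤ 12 / ((2 * (i : ℝ) + 10) * ((k : ℝ) - i)) := by
            apply div_le_div_of_nonneg_left (by norm_num) (by positivity)
            exact mul_le_mul h1 h2 hki.le (by positivity)
        _ = 6 / (((i : ℝ) + 5) * ((k : ℝ) - i)) := by
            field_simp; ring
    have hM := many_factor_sum k hk50
    linarith

/-! ## §4 Orders and `tauV` -/

/-- `ord_m(p) ≥ ⌊log_p (p m)⌋` for `p` prime, `gcd (p, m) = 1`, `m ≥ 1`. -/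
theorem log_le_orderOf (p m : ℕ) (hp : p.Prime) (hcop : Nat.Coprime p m) (hm : 0 < m) :
    Nat.log p (p * m) ≤ orderOf ((p : ℕ) : ZMod m) := by
  rcases (by omega : m = 1 ∨ 2 ≤ m) with h1 | h2
  · subst h1
    have : ((p : ℕ) : ZMod 1) = 1 := Subsingleton.elim _ _
    rw [this, orderOf_one, mul_one]
    have h2 := hp.two_le
    have hlt : p < p ^ 2 := by nlinarith
    have := Nat.log_lt_of_lt_pow (by omega) hlt
    omega
  · set x : ZMod m := ((p : ℕ) : ZMod m) with hx
    have hmod : p ^ m.totient % m = 1 % m := Nat.ModEq.pow_totient hcop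
    have hpow : x ^ m.totient = 1 := by
      have := (ZMod.natCast_eq_natCast_iff' (p ^ m.totient) 1 m).mpr hmod
      push_cast at this
      exact this
    have hfin : IsOfFinOrder x :=
      isOfFinOrder_iff_pow_eq_one.mpr ⟨m.totient, Nat.totient_pos.mpr hm, hpow⟩
    have hord : 0 < orderOf x := orderOf_pos_iff.mpr hfin
    set n := orderOf x with hn
    have hxn : x ^ n = 1 := pow_orderOf_eq_one x
    have hmodn : p ^ n % m = 1 % m := by
      apply (ZMod.natCast_eq_natCast_iff' (p ^ n) 1 m).mp
      push_cast; exact hxn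
    rw [Nat.mod_eq_of_lt (by omega : 1 < m)] at hmodn
    have hge : m + 1 ≤ p ^ n := by
      have hdiv := Nat.div_add_mod (p ^ n) m
      rw [hmodn] at hdiv
      have hpn : p ≤ p ^ n := Nat.le_self_pow (by omega) p
      have hq : 1 ≤ p ^ n / m := by
        rcases Nat.eq_zero_or_pos (p ^ n / m) with h0 | h0
        · rw [h0, mul_zero, zero_add] at hdiv
          have := hp.two_le
          omega
        · exact h0
      nlinarith
    have hlt : p * m < p ^ (n + 1) := by
      rw [pow_succ]
      nlinarith [hp.pos]
    have := Nat.log_lt_of_lt_pow (Nat.mul_pos hp.pos hm).ne' hlt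
    omega

/-- `tauV N p ≤ φ(N/p) / d` for any `0 < d ≤ ord_{N/p}(p)`. -/
theorem tauV_le (N p d : ℕ) (hd : 0 < d) (hdo : d ≤ orderOf ((p : ℕ) : ZMod (N / p))) :
    (tauV N p : ℝ) ≤ ((N / p).totient : ℝ) / d := by
  unfold tauV
  calc (((N / p).totient / orderOf ((p : ℕ) : ZMod (N / p)) : ℕ) : ℝ)
      ≤ ((N / p).totient : ℝ) / (orderOf ((p : ℕ) : ZMod (N / p)) : ℝ) := Nat.cast_div_le
    _ ≤ ((N / p).totient : ℝ) / d := by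
        apply div_le_div_of_nonneg_left (by positivity) (by exact_mod_cast hd)
        exact_mod_cast hdo


end HodgeFermat.KRFree.HypVTail
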